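import Summits.QuantumFields.YangMills.Theses.UnitScaleTilt

/-!
# `HistoryTailL` (stmt-QuantumFields-19936) needs only ONE profile per `L` — the monotone lift

crux-ideate 2/2 on stmt-QuantumFields-18916 → 19936 (ideator `ym-cruxidea-18916-2`, gen 3, lens NEGATION), 2026-08-27.

NEGATION-LENS STRUCTURAL FINDING.  The UV-small-history events are NESTED in the profile: for `0 < γ ≤ 1`, `1 ≤ L`,
`0 ≤ b₀ ≤ b₀'`, `p₀ ≤ p₀'` one has `θBal L γ b₀ p₀ i ≤ θBal L γ b₀' p₀' i` for every height `i` (the base `1 + log g_i⁻¹ ≥ 1`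
because `g_i = √(γL^{-i}) ≤ 1`), hence `histGood(θBal(b₀,p₀)) ⊆ histGood(θBal(b₀',p₀'))` (`PlaqSmall` is `dist1 < δ`, monotone in
`δ`), hence the complements SHRINK and `HistoryTailAt F γ b₀ p₀ m → HistoryTailAt F γ b₀' p₀' m` with the same summable `w`.
Consequently the ERRATUM-v3 crux

  `HistoryTailL : ∀ L b₁ p₁, ∃ (b₀,p₀) ⪰ (b₁,p₁), 0 < b₀ ∧ 2 < p₀ ∧ ∀ m > 0, ∃ γ₁ > 0, ∀ F γ …, HistoryTailAt F γ b₀ p₀ m`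

is EQUIVALENT (`historyTailL_iff_oneProfile`, kernel-checked below) to the ONE-PROFILE statement

  `HistoryTailOneProfile : ∀ L, ∃ b₀ p₀, 0 < b₀ ∧ 2 < p₀ ∧ ∀ m > 0, ∃ γ₁ > 0, ∀ F γ …, HistoryTailAt F γ b₀ p₀ m`

(= the aside `HistoryTail` with the profile — not `γ₁` — chosen before `m`; v4's `HistoryTail_of` 2dd95f606719a12c and v5p's
composition ALREADY choose `(b₀,p₀,γ₁)` from `stub_perPlaquetteHighRaw L …` before touching `m`, i.e. they prove
`HistoryTailOneProfile` verbatim).  So on the HISTORY side the «for all sufficiently large (b₀,p₀)» strengthening has no teeth: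
v5p′ may pin the profile to ONE lane record's own `(𝔠.b₀, 𝔠.p₀)` (F-owner-g17-1: a run serves exactly its own p-function) and
conclude `HistoryTailL` by `historyTailL_of_oneProfile`; no stub of v5p′ needs to be uniform in, or parametrised by, the
thresholds `(b₁,p₁)` — in particular `stub_perPlaquetteSmallBlocks` (odd `L < 7`) need only produce ONE profile, and 4c's exponent
algebra runs at the native `p₀ = 2r₀+1` (`2p₀ = 4r₀+2 > 2+3r₀` automatically).  The tilt side is NOT touched by this remark
(there the comparison is genuinely per profile; `FluctuationComparisonRegPrL` keeps its `∀ (b₀,p₀) ⪰ (b₁,p₁)`), and `closes`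
(rev ≥ 7) composes unchanged: it asks `HistoryTailL` at the tilt side's thresholds and receives `(max b₀ b₁, max p₀ p₁)`.

This corrects, for the history side only, OWNER-RULING-g17-1 §A (4) «no monotonicity rescue: the events histGood(θBal(b₀,p₀)) are
not nested usefully across profiles» — they are nested (upward in the profile), which is exactly the direction `HistoryTailL` asks for.
-/

namespace Summit.QuantumFields.YangMills.Cruxes.HistoryTailL.Ideas18916i2Mono

open MeasureTheory
open Literature.MathematicalPhysics.QuantumFieldTheory.Balaban1983to89
open Literature.MathematicalPhysics.QuantumFieldTheory.Balaban1983to89.T3ContinuumYM3Torus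
open Literature.MathematicalPhysics.QuantumFieldTheory.Balaban1983to89.T3UnitLawDensityEML (ℰp)
open Summit.QuantumFields.YangMills.Theses.UnitScaleTilt

/-! ## §1 Monotonicity of the thresholds and of the small-history events -/

/-- `pFun b₀ p₀ g = b₀(1 + log g⁻¹)^{p₀}` is monotone in the profile for `0 < g ≤ 1`, `0 ≤ b₀`. -/
theorem pFun_mono {b₀ b₀' p₀ p₀' g : ℝ} (hb : 0 ≤ b₀) (hbb : b₀ ≤ b₀') (hpp : p₀ ≤ p₀') (hg : 0 < g) (hg1 : g ≤ 1) :
    B10.pFun b₀ p₀ g ≤ B10.pFun b₀' p₀' g := by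
  unfold B10.pFun
  have hlog : 0 ≤ Real.log g⁻¹ := by
    rw [Real.log_inv]
    have := Real.log_nonpos hg.le hg1
    linarith
  have ht : (1 : ℝ) ≤ 1 + Real.log g⁻¹ := by linarith
  have h1 : (1 + Real.log g⁻¹) ^ p₀ ≤ (1 + Real.log g⁻¹) ^ p₀' := Real.rpow_le_rpow_of_exponent_le ht hpp
  have h2 : 0 ≤ (1 + Real.log g⁻¹) ^ p₀' := Real.rpow_nonneg (by linarith) _
  calc b₀ * (1 + Real.log g⁻¹) ^ p₀ ≤ b₀ * (1 + Real.log g⁻¹) ^ p₀' := mul_le_mul_of_nonneg_left h1 hb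
    _ ≤ b₀' * (1 + Real.log g⁻¹) ^ p₀' := mul_le_mul_of_nonneg_right hbb h2

/-- The effective coupling `g_i = √(γL^{-i})` lies in `(0,1]` for `0 < γ ≤ 1`, `1 ≤ L`. -/
theorem sqrt_coupling_mem {L : ℕ} (hL : 1 ≤ L) {γ : ℝ} (hγ : 0 < γ) (hγ1 : γ ≤ 1) (i : ℕ) :
    0 < Real.sqrt (γ * ((L : ℝ)⁻¹) ^ i) ∧ Real.sqrt (γ * ((L : ℝ)⁻¹) ^ i) ≤ 1 := by
  have hL' : (1 : ℝ) ≤ L := by exact_mod_cast hL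
  have hLi : 0 < ((L : ℝ)⁻¹) ^ i := pow_pos (inv_pos.mpr (by linarith)) i
  have hLi1 : ((L : ℝ)⁻¹) ^ i ≤ 1 := pow_le_one₀ (inv_nonneg.mpr (by linarith)) (inv_le_one_of_one_le₀ hL')
  refine ⟨Real.sqrt_pos.mpr (mul_pos hγ hLi), Real.sqrt_le_one.mpr ?_⟩
  calc γ * ((L : ℝ)⁻¹) ^ i ≤ 1 * 1 := mul_le_mul hγ1 hLi1 hLi.le zero_le_one
    _ = 1 := one_mul 1

/-- `θBal` is monotone in the profile `(b₀,p₀)` at every height, for `0 < γ ≤ 1`, `1 ≤ L`, `0 ≤ b₀`. -/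
theorem θBal_mono {L : ℕ} (hL : 1 ≤ L) {γ b₀ b₀' p₀ p₀' : ℝ} (hγ : 0 < γ) (hγ1 : γ ≤ 1)
    (hb : 0 ≤ b₀) (hbb : b₀ ≤ b₀') (hpp : p₀ ≤ p₀') (i : ℕ) :
    T3UnitScaleTilt.θBal L γ b₀ p₀ i ≤ T3UnitScaleTilt.θBal L γ b₀' p₀' i := by
  unfold T3UnitScaleTilt.θBal
  obtain ⟨h0, h1⟩ := sqrt_coupling_mem hL hγ hγ1 i
  exact mul_le_mul_of_nonneg_left (pFun_mono hb hbb hpp h0 h1) h0.le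

/-- The small-history events are monotone in the threshold function. -/
theorem histGood_mono (F : T3Family) {G : Type*} [GaugeGroup G] [MeasurableSpace G] [RegularGaugeGroup G]
    (ℰ : LoopAverage G) {θ θ' : ℕ → ℝ} (h : ∀ i, θ i ≤ θ' i) (K n : ℕ) :
    T3UnitScaleTilt.histGood F ℰ θ K n ⊆ T3UnitScaleTilt.histGood F ℰ θ' K n := by
  intro U hU j hj p
  exact lt_of_lt_of_le (hU j hj p) (h _)

/-- **Monotone lift of the history tail**: a larger profile has smaller bad-history events, so the same summable `w` works. -/
theorem historyTailAt_mono (F : T3Family) {γ b₀ b₀' p₀ p₀' : ℝ} {m : ℕ} (hγ : 0 < γ) (hγ1 : γ ≤ 1)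
    (hb : 0 ≤ b₀) (hbb : b₀ ≤ b₀') (hpp : p₀ ≤ p₀')
    (h : T3UnitScaleTilt.HistoryTailAt F γ b₀ p₀ m) : T3UnitScaleTilt.HistoryTailAt F γ b₀' p₀' m := by
  obtain ⟨w, hw, hK⟩ := h
  have hL1 : 1 ≤ F.L := F.hL.2.le
  have hθ : ∀ i, T3UnitScaleTilt.θBal F.L γ b₀ p₀ i ≤ T3UnitScaleTilt.θBal F.L γ b₀' p₀' i :=
    θBal_mono hL1 hγ hγ1 hb hbb hpp
  have hsub : ∀ K n,
      (T3UnitScaleTilt.histGood F ℰp (T3UnitScaleTilt.θBal F.L γ b₀' p₀') K n)ᶜ ⊆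
        (T3UnitScaleTilt.histGood F ℰp (T3UnitScaleTilt.θBal F.L γ b₀ p₀) K n)ᶜ := fun K n =>
    Set.compl_subset_compl.mpr (histGood_mono F ℰp hθ K n)
  refine ⟨w, hw, fun K => ?_⟩
  haveI := T3UnitScaleTilt.isProbabilityMeasure_gibbsK F ℰp hγ.le K
  haveI := T3UnitScaleTilt.isProbabilityMeasure_gibbsK F ℰp hγ.le (K + 1)
  exact ⟨(measureReal_mono (hsub K _)).trans (hK K).1, (measureReal_mono (hsub (K + 1) _)).trans (hK K).2⟩

/-! ## §2 The equivalence `HistoryTailL ↔ HistoryTailOneProfile` -/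

/-- ONE profile per `L`, chosen before the free top fraction `m` (what v4's `HistoryTail_of` / v5p's composition prove verbatim). -/
def HistoryTailOneProfile : Prop :=
  ∀ (L : ℕ), ∃ (b₀ p₀ : ℝ), 0 < b₀ ∧ 2 < p₀ ∧ ∀ (m : ℕ), 0 < m → ∃ γ₁ : ℝ, 0 < γ₁ ∧
    ∀ (F : T3Family) (γ : ℝ), F.L = L → 0 < γ → γ ≤ γ₁ → T3UnitScaleTilt.HistoryTailAt F γ b₀ p₀ m

/-- One profile ⇒ every pair of thresholds is served (profile `(max b₀ b₁, max p₀ p₁)`, coupling threshold `min γ₁ 1`). -/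
theorem historyTailL_of_oneProfile (h : HistoryTailOneProfile) : HistoryTailL := by
  intro L b₁ p₁
  obtain ⟨b₀, p₀, hb, hp, hm⟩ := h L
  refine ⟨max b₀ b₁, max p₀ p₁, le_max_right _ _, le_max_right _ _, lt_max_of_lt_left hb, lt_max_of_lt_left hp,
    fun m hm0 => ?_⟩
  obtain ⟨γ₁, hγ₁, hT⟩ := hm m hm0
  refine ⟨min γ₁ 1, lt_min hγ₁ one_pos, fun F γ hFL hγ hle => ?_⟩
  exact historyTailAt_mono F hγ (hle.trans (min_le_right _ _)) hb.le (le_max_left _ _) (le_max_left _ _)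
    (hT F γ hFL hγ (hle.trans (min_le_left _ _)))

/-- The converse is the instance `b₁ = p₁ = 0`. -/
theorem oneProfile_of_historyTailL (h : HistoryTailL) : HistoryTailOneProfile := by
  intro L
  obtain ⟨b₀, p₀, -, -, hb, hp, hT⟩ := h L 0 0
  exact ⟨b₀, p₀, hb, hp, hT⟩

/-- **`HistoryTailL ↔ HistoryTailOneProfile`.** -/
theorem historyTailL_iff_oneProfile : HistoryTailL ↔ HistoryTailOneProfile :=
  ⟨oneProfile_of_historyTailL, historyTailL_of_oneProfile⟩

/-- Corollary for the v5p′ composition: the per-plaquette road may fix ANY single profile with `0 < b₀`, `2 < p₀` (e.g. a lane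
record's own `(𝔠.b₀, 𝔠.p₀)`), prove `HistoryTailAt` there for every `m` with a volume-uniform `γ₁(m)`, and conclude the crux. -/
theorem historyTailL_of_profile
    (h : ∀ (L : ℕ), ∃ (b₀ p₀ : ℝ), 0 < b₀ ∧ 2 < p₀ ∧ ∀ (m : ℕ), 0 < m → ∃ γ₁ : ℝ, 0 < γ₁ ∧
      ∀ (F : T3Family) (γ : ℝ), F.L = L → 0 < γ → γ ≤ γ₁ → T3UnitScaleTilt.HistoryTailAt F γ b₀ p₀ m) :
    HistoryTailL :=
  historyTailL_of_oneProfile h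

end Summit.QuantumFields.YangMills.Cruxes.HistoryTailL.Ideas18916i2Mono
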